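import Literature.LinearAlgebra.TensorNetworks.JunctionTree
import Mathlib.Algebra.BigOperators.Ring.Finset
import Mathlib.Tactic.Ring
import HarnessLib

/-!
# Route MonotoneRestoration — crux `OrbitRestorationQP` (stmt-ValiantsHypothesis-18293), sub-crux K2 `HomPolyClose`
# Step 2: the junction-tree construction of an EXPRESSION along a rooted tree decomposition (abstract form)

Helper toward the archived stub `stub_homPoly_close` of line `narrow-expansion`.  The closed polynomial of
a labelled pattern expression is a nested sum; to realise a sum of products `Σ_g ∏_φ φ(g)` (a homomorphism
polynomial) as ONE expression we run Dechter's bucket elimination / the junction-tree algorithm along a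
rooted tree decomposition housing every factor — exactly the algorithm whose TABLE form is proved correct in
`Literature/LinearAlgebra/TensorNetworks/JunctionTree.lean` (`JT.dpValue_eq_netValue`) — but with messages
that are EXPRESSIONS instead of tables: the message of bag `t` is
`Σ_{private variables of t} (∏ factors housed at t) · (∏ messages of the children of t)`, written with the
expression formers "sum out the register of variable `v`" (`W v`), product (`mulE`) and unit (`oneE`).

This file is the abstract, model-independent half: an expression type `E` with a semantics
`val : E → σ → R` on register states `σ`, a reading `r : σ → (ℕ → ℕ)` of the registers as an assignment of
the variables, a register update `U`, and the hypotheses that (i) `W v` sums over the values of the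
register of `v` (`hW`), (ii) updating the register of `v` changes the reading exactly at `v` among the
variables of any one bag (`hU` — this is where a bag-injective labelling of the variables by registers is
used), (iii) factor expressions evaluate to the factors read off the registers (`hee`), factors depend on
their scopes only (`hloc`).  Conclusion (`exists_expr_val_eq_sum`): some expression evaluates, at EVERY
register state, to `Σ_{g ∈ assignments} ∏_{φ ∈ fs} φ(g)`.  Step 3 instantiates it with labelled pattern
expressions (`Literature/Computability/AlgebraicComplexity/PatternExpressions.lean`).

* `list_sum_map_finset_sum` (swapping a list sum and a finite sum), `val_foldr_mul` (products),
  `val_foldl_sumOut` (summing out a list of variables enumerates `ListTD.allAssign`),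
  `updList_congr_of_mem`, `updList_congr_on` (overrides agreeing on a bag),
  `read_foldr_update` (reading the registers after summing out = `ListTD.updList` on the bag);
* the step `exprInv_step` of the descending run (JT's `Inv` with expression messages: every recorded
  message carries an expression, its meaning `M : (ℕ → ℕ) → R`, the identity `val expr st = M (r st)`
  and the locality of `M` in the key variables), and **`exists_expr_val_eq_sum`** (no `def`: the
  invariant is spelled out).

Adapted from `Literature/LinearAlgebra/TensorNetworks/JunctionTree.lean` (same invariant, same splitting
of the products, `JT.sum_assignments_elimList` for the elimination step).

## References

* R. Dechter, *Bucket elimination: a unifying framework for reasoning*, Artif. Intell. 113 (1999), §4.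
* A. Dawar, B. Pago, T. Seppelt, *Symmetric algebraic circuits and homomorphism polynomials*,
  arXiv:2502.06740 (2025), §5 (proof of Thm 5.3: the gates `F(v)`, `v ∈ [n]^ℓ`, along a decomposition).
* L. Lovász, *Large networks and graph limits*, AMS 2012, §6.5.
-/

-- `Summit.ValiantsHypothesis.ValiantsHypothesis.…` is the tree's single-conjunct layout (Sub = Summit).
set_option linter.dupNamespace false

namespace Summit.ValiantsHypothesis.ValiantsHypothesis.Theorems.OrbitRestorationQPHomPolyClose

open Finset Literature.Combinatorics.SimpleGraph.ListTD Literature.LinearAlgebra.TensorNetworks.JT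

/-! ### Small algebra -/

/-- Swapping a list sum with a finite sum. [folklore] -/
theorem list_sum_map_finset_sum {ι α M : Type*} [AddCommMonoid M] (s : Finset ι) (G : ι → α → M) :
    ∀ L : List α, (L.map fun l => ∑ x ∈ s, G x l).sum = ∑ x ∈ s, (L.map (G x)).sum
  | [] => by simp
  | l :: L => by
    rw [List.map_cons, List.sum_cons, list_sum_map_finset_sum s G L, ← Finset.sum_add_distrib]
    simp

section Abstract

variable {R : Type*} [CommSemiring R] {E σ Φ : Type*}

/-- **Products of expressions evaluate to products.** [folklore] -/
theorem val_foldr_mul (val : E → σ → R) (mulE : E → E → E) (oneE : E)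
    (hmul : ∀ e₁ e₂ st, val (mulE e₁ e₂) st = val e₁ st * val e₂ st) (hone : ∀ st, val oneE st = 1)
    (st : σ) : ∀ l : List E, val (l.foldr mulE oneE) st = (l.map fun e => val e st).prod
  | [] => by simp [hone]
  | e :: l => by
    rw [List.foldr_cons, hmul, val_foldr_mul val mulE oneE hmul hone st l, List.map_cons, List.prod_cons]

/-- **Summing out a list of variables enumerates their value lists**: if `W v e` evaluates to the sum
of the values of `e` over the updates of the register of `v`, then summing out `P` (innermost variable
first) evaluates to the sum over `allAssign d P` of the values at the correspondingly updated states.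
[folklore] -/
theorem val_foldl_sumOut (val : E → σ → R) (W : ℕ → E → E) (U : σ → ℕ → ℕ → σ) (d : ℕ)
    (hW : ∀ v e st, val (W v e) st = ∑ x ∈ Finset.range d, val e (U st v x)) :
    ∀ (P : List ℕ) (e : E) (st : σ), val (P.foldl (fun e v => W v e) e) st =
      ((allAssign d P).map fun pv => val e ((P.zip pv).foldr (fun q s => U s q.1 q.2) st)).sum
  | [], e, st => by simp [allAssign]
  | v :: P, e, st => by
    rw [List.foldl_cons, val_foldl_sumOut val W U d hW P (W v e) st, sum_map_allAssign_cons]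
    simp_rw [hW]
    rw [list_sum_map_finset_sum]
    rfl

/-- Overriding a variable of `P` does not depend on the map overridden. [folklore] -/
theorem updList_congr_of_mem (g g' : ℕ → ℕ) : ∀ {P pv : List ℕ} {v : ℕ},
    v ∈ P → P.length ≤ pv.length → updList g P pv v = updList g' P pv v
  | [], _, _, hv, _ => absurd hv List.not_mem_nil
  | _ :: _, [], _, _, hlen => by simp at hlen
  | u :: P, x :: pv, v, hv, hlen => by
    rw [updList, updList]
    by_cases h : v = u
    · subst h; simp
    · rw [Function.update_of_ne h, Function.update_of_ne h]
      exact updList_congr_of_mem g g' ((List.mem_cons.1 hv).resolve_left h) (by simpa using hlen)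

/-- **Overrides of maps agreeing off `P` on a set `B` agree on `B`.** [folklore] -/
theorem updList_congr_on {g g' : ℕ → ℕ} {P pv : List ℕ} {B : List ℕ}
    (hlen : P.length ≤ pv.length) (hg : ∀ v ∈ B, v ∉ P → g v = g' v) :
    ∀ v ∈ B, updList g P pv v = updList g' P pv v := by
  intro v hv
  by_cases hvP : v ∈ P
  · exact updList_congr_of_mem g g' hvP hlen
  · rw [updList_of_not_mem g pv hvP, updList_of_not_mem g' pv hvP, hg v hv hvP]

/-- **Reading the registers after a list of updates**: if updating the register of `v ∈ B` by `x < d`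
changes the reading exactly at `v` among the variables of `B`, then after the updates of `P ⊆ B` by the
values `pv` (all `< d`) the reading is, on `B`, the original reading overridden by `pv` on `P`.
[folklore] -/
theorem read_foldr_update (r : σ → ℕ → ℕ) (U : σ → ℕ → ℕ → σ) (d : ℕ) {B : List ℕ}
    (hU : ∀ st, ∀ u ∈ B, ∀ v ∈ B, ∀ x, x < d → r (U st v x) u = if u = v then x else r st u)
    (st : σ) : ∀ (P pv : List ℕ), (∀ v ∈ P, v ∈ B) → pv.length = P.length → (∀ x ∈ pv, x < d) →
      ∀ u ∈ B, r ((P.zip pv).foldr (fun q s => U s q.1 q.2) st) u = updList (r st) P pv u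
  | [], pv, _, hlen, _, u, _ => by
    cases pv with
    | nil => rfl
    | cons _ _ => simp at hlen
  | v :: P, [], _, hlen, _, _, _ => by simp at hlen
  | v :: P, x :: pv, hP, hlen, hpv, u, hu => by
    rw [List.zip_cons_cons, List.foldr_cons, updList]
    rw [hU _ u hu v (hP v List.mem_cons_self) x (hpv x List.mem_cons_self)]
    by_cases huv : u = v
    · subst huv; simp
    · rw [if_neg huv, Function.update_of_ne huv]
      exact read_foldr_update r U d hU st P pv (fun w hw => hP w (List.mem_cons_of_mem v hw))
        (by simpa using hlen) (fun y hy => hpv y (List.mem_cons_of_mem x hy)) u hu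

/-! ### The run with expression messages -/

section Run

variable {val : E → σ → R} {r : σ → ℕ → ℕ} {d nv : ℕ} {par : List ℕ} {bags : List (List ℕ)}
  {scope : Φ → List ℕ} {fe : Φ → (ℕ → ℕ) → R} {fs : List Φ}

/-- **The step**: processing bag `t` — recording the expression
`Σ_{privVars t} (∏ factor expressions housed at t) · (∏ children's expressions)` with its meaning —
preserves the invariant. [folklore] -/
theorem exprInv_step (W : ℕ → E → E) (U : σ → ℕ → ℕ → σ) (mulE : E → E → E) (oneE : E) (ee : Φ → E)
    (hD : IsRootedTD nv par bags)
    (hW : ∀ v e st, val (W v e) st = ∑ x ∈ Finset.range d, val e (U st v x))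
    (hmul : ∀ e₁ e₂ st, val (mulE e₁ e₂) st = val e₁ st * val e₂ st) (hone : ∀ st, val oneE st = 1)
    (hee : ∀ φ ∈ fs, ∀ st, val (ee φ) st = fe φ (r st))
    (hloc : ∀ φ ∈ fs, ∀ g g' : ℕ → ℕ, (∀ v ∈ scope φ, g v = g' v) → fe φ g = fe φ g')
    (hU : ∀ t st, ∀ u ∈ bagOf bags t, ∀ v ∈ bagOf bags t, ∀ x, x < d →
      r (U st v x) u = if u = v then x else r st u)
    {t : ℕ} (ht : t < bags.length) {msgs : List (ℕ × E × ((ℕ → ℕ) → R))}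
    (hfst : msgs.map Prod.fst = List.range' (t + 1) (bags.length - (t + 1)))
    (hval : ∑ g ∈ assignments (Finset.range nv) d, (fs.map fun φ => fe φ g).prod =
      ∑ g ∈ assignments (liveVars nv par bags (t + 1)) d,
        ((fs.filter fun φ => decide (homeOf bags (scope φ) < t + 1)).map fun φ => fe φ g).prod *
        ((msgs.filter fun m => decide (m.1 = 0 ∨ parOf par m.1 < t + 1)).map fun m => m.2.2 g).prod)
    (hmsg : ∀ m ∈ msgs, (∀ st, val m.2.1 st = m.2.2 (r st)) ∧
      ∀ g g' : ℕ → ℕ, (∀ v ∈ keptVars par bags m.1, g v = g' v) → m.2.2 g = m.2.2 g') :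
    ∃ m : ℕ × E × ((ℕ → ℕ) → R),
      (m :: msgs).map Prod.fst = List.range' t (bags.length - t) ∧
      (∑ g ∈ assignments (Finset.range nv) d, (fs.map fun φ => fe φ g).prod =
        ∑ g ∈ assignments (liveVars nv par bags t) d,
          ((fs.filter fun φ => decide (homeOf bags (scope φ) < t)).map fun φ => fe φ g).prod *
          (((m :: msgs).filter fun m => decide (m.1 = 0 ∨ parOf par m.1 < t)).map
            fun m => m.2.2 g).prod) ∧
      ∀ m' ∈ m :: msgs, (∀ st, val m'.2.1 st = m'.2.2 (r st)) ∧
        ∀ g g' : ℕ → ℕ, (∀ v ∈ keptVars par bags m'.1, g v = g' v) → m'.2.2 g = m'.2.2 g' := by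
  classical
  -- the indices of the recorded messages
  have hidx : ∀ m ∈ msgs, t + 1 ≤ m.1 ∧ m.1 < bags.length := by
    intro m hm
    have : m.1 ∈ msgs.map Prod.fst := List.mem_map_of_mem hm
    rw [hfst, List.mem_range'] at this
    omega
  -- the data of the step
  set K := keptVars par bags t with hK
  set P := privVars par bags t with hP
  set fsT := fs.filter fun φ => decide (homeOf bags (scope φ) = t) with hfsT
  set ch := msgs.filter fun m => decide (m.1 ≠ 0 ∧ parOf par m.1 = t) with hch
  set A' : (ℕ → ℕ) → R := fun a =>
    ((fs.filter fun φ => decide (homeOf bags (scope φ) < t)).map fun φ => fe φ a).prod with hA'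
  set At : (ℕ → ℕ) → R := fun a => (fsT.map fun φ => fe φ a).prod with hAt
  set B' : (ℕ → ℕ) → R := fun a =>
    ((msgs.filter fun m => decide (m.1 = 0 ∨ parOf par m.1 < t)).map fun m => m.2.2 a).prod with hB'
  set Bt : (ℕ → ℕ) → R := fun a => (ch.map fun m => m.2.2 a).prod with hBt
  set Mt : (ℕ → ℕ) → R := fun a =>
    ((allAssign d P).map fun pv => At (updList a P pv) * Bt (updList a P pv)).sum with hMt
  set body : E := mulE ((fsT.map ee).foldr mulE oneE) ((ch.map fun m => m.2.1).foldr mulE oneE)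
    with hbody
  set mt : E := P.foldl (fun e v => W v e) body with hmt
  refine ⟨(t, mt, Mt), ?_, ?_, ?_⟩
  · -- (1) indices
    have hn : bags.length - t = (bags.length - (t + 1)) + 1 := by omega
    rw [List.map_cons, hfst, hn, List.range'_succ]
  · -- (2) the value identity, as in `JT.inv_step`
    have hsplitA : ∀ a, ((fs.filter fun φ => decide (homeOf bags (scope φ) < t + 1)).map
        fun φ => fe φ a).prod = A' a * At a := fun a =>
      prod_map_filter_split _ (fun φ => decide (homeOf bags (scope φ) < t))
        (fun φ => decide (homeOf bags (scope φ) = t)) _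
        (fun φ => by rw [Bool.eq_iff_iff]; simp only [Bool.or_eq_true, decide_eq_true_eq]; omega)
        (fun φ hp => by simp only [decide_eq_true_eq] at hp; simp only [decide_eq_false_iff_not]; omega) fs
    have hfilt : (msgs.filter fun m => decide (m.1 = 0 ∨ parOf par m.1 < t + 1)) =
        msgs.filter fun m => (decide (m.1 ≠ 0 ∧ parOf par m.1 = t) ||
          decide (m.1 = 0 ∨ parOf par m.1 < t)) := by
      refine List.filter_congr fun m hm => ?_
      have := hidx m hm
      rw [Bool.eq_iff_iff]
      simp only [Bool.or_eq_true, decide_eq_true_eq]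
      omega
    have hsplitB : ∀ a, ((msgs.filter fun m => decide (m.1 = 0 ∨ parOf par m.1 < t + 1)).map
        fun m => m.2.2 a).prod = Bt a * B' a := fun a => by
      rw [hfilt]
      exact prod_map_filter_split (fun m : ℕ × E × ((ℕ → ℕ) → R) => m.2.2 a)
        (fun m => decide (m.1 ≠ 0 ∧ parOf par m.1 = t))
        (fun m => decide (m.1 = 0 ∨ parOf par m.1 < t)) _ (fun m => rfl)
        (fun m hp => by simp only [decide_eq_true_eq] at hp; simp only [decide_eq_false_iff_not]; omega)
        msgs
    -- sum out the private variables of `t`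
    have hPnd : P.Nodup := nodup_privVars (hD.bag_nodup t) (hD.bag_nodup 0)
    have hPD : ∀ v ∈ P, v ∈ liveVars nv par bags (t + 1) := fun v hv =>
      mem_liveVars_succ_of_mem_privVars hD hv
    have hG : ∀ v ∈ P, ∀ (a : ℕ → ℕ) (x : ℕ), A' (Function.update a v x) * B' (Function.update a v x) =
        A' a * B' a := by
      intro v hv a x
      congr 1
      · simp only [hA']
        congr 1
        refine List.map_congr_left fun φ hφ => ?_
        obtain ⟨hφfs, hφt⟩ := List.mem_filter.1 hφ
        simp only [decide_eq_true_eq] at hφt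
        refine hloc φ hφfs _ _ fun w hw => Function.update_of_ne ?_ _ _
        rintro rfl
        exact not_mem_scope_of_homeOf_lt hD ht hφt hv hw
      · simp only [hB']
        congr 1
        refine List.map_congr_left fun m hm => ?_
        obtain ⟨hmm, hmt⟩ := List.mem_filter.1 hm
        simp only [decide_eq_true_eq] at hmt
        have hpar : parOf par m.1 < t := by
          rcases hmt with h0 | h
          · have := hidx m hmm; omega
          · exact h
        refine (hmsg m hmm).2 _ _ fun w hw => Function.update_of_ne ?_ _ _
        rintro rfl
        exact not_mem_keptVars_of_parent_lt hD ht hpar hv hw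
    have hstep := sum_assignments_elimList d (fun a => At a * Bt a) P (liveVars nv par bags (t + 1))
      (fun a => A' a * B' a) hPnd hPD hG
    -- assemble
    rw [hval]
    simp_rw [hsplitA, hsplitB]
    have hre : ∀ a, A' a * At a * (Bt a * B' a) = (A' a * B' a) * (At a * Bt a) := fun a => by ring
    simp_rw [hre]
    rw [hstep, liveVars_succ_sdiff nv par bags ht]
    refine Finset.sum_congr rfl fun a _ => ?_
    have hpend : t = 0 ∨ parOf par t < t := by
      rcases Nat.eq_zero_or_pos t with h0 | hpos
      · exact Or.inl h0
      · exact Or.inr (hD.par_lt t hpos ht)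
    rw [List.filter_cons, if_pos (by simp only [decide_eq_true_eq]; exact hpend), List.map_cons,
      List.prod_cons]
    show A' a * B' a * Mt a = A' a * (Mt a * B' a)
    ring
  · -- (3) the expressions and the locality of the meanings
    -- the product at `t` depends on the variables of bag `t` only
    have hAtBt : ∀ g g' : ℕ → ℕ, (∀ v ∈ bagOf bags t, g v = g' v) → At g * Bt g = At g' * Bt g' := by
      intro g g' hgg'
      congr 1
      · simp only [hAt]
        congr 1
        refine List.map_congr_left fun φ hφ => ?_
        obtain ⟨hφfs, hφt⟩ := List.mem_filter.1 hφ
        simp only [decide_eq_true_eq] at hφt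
        refine hloc φ hφfs _ _ fun w hw => hgg' w ?_
        exact hφt ▸ subset_bagOf_homeOf (hφt ▸ ht) w hw
      · simp only [hBt]
        congr 1
        refine List.map_congr_left fun m hm => ?_
        obtain ⟨hmm, hmt⟩ := List.mem_filter.1 hm
        simp only [decide_eq_true_eq] at hmt
        refine (hmsg m hmm).2 _ _ fun w hw => hgg' w ?_
        exact hmt.2 ▸ (mem_parent_of_mem_keptVars hw).2
    have hPB : ∀ v ∈ P, v ∈ bagOf bags t := fun v hv => mem_bagOf_of_mem_privVars hv
    intro m hm
    rcases List.mem_cons.1 hm with rfl | hm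
    · refine ⟨fun st => ?_, fun g g' hgg' => ?_⟩
      · -- the expression evaluates to the meaning
        show val mt st = Mt (r st)
        rw [hmt, val_foldl_sumOut val W U d hW]
        simp only [hMt]
        congr 1
        refine List.map_congr_left fun pv hpv => ?_
        obtain ⟨hlen, hlt⟩ := mem_allAssign.1 hpv
        have hread := read_foldr_update r U d (hU t) st P pv hPB hlen hlt
        rw [hbody, hmul, val_foldr_mul val mulE oneE hmul hone, val_foldr_mul val mulE oneE hmul hone,
          List.map_map, List.map_map]
        rw [← hAtBt _ _ hread]
        congr 1
        · simp only [hAt]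
          congr 1
          refine List.map_congr_left fun φ hφ => ?_
          exact hee φ (List.mem_filter.1 hφ).1 _
        · simp only [hBt]
          congr 1
          refine List.map_congr_left fun m hm => ?_
          exact (hmsg m (List.mem_filter.1 hm).1).1 _
      · -- the meaning depends on the key variables only
        show Mt g = Mt g'
        simp only [hMt]
        congr 1
        refine List.map_congr_left fun pv hpv => ?_
        obtain ⟨hlen, -⟩ := mem_allAssign.1 hpv
        refine hAtBt _ _ (updList_congr_on hlen.symm.le fun v hv hvP => hgg' v ?_)
        exact ((mem_bagOf_iff (par := par)).1 hv).resolve_right hvP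
    · exact hmsg m hm

/-- **The junction-tree expression.** Along a rooted tree decomposition (list form) housing every
factor, with a nonempty domain, factors depending on their scopes only, factor expressions, products,
and "summing out a register" realised in the expression model, and registers reading back correctly on
every bag: SOME expression evaluates, at every register state, to the total sum of products
`Σ_{g ∈ assignments} ∏_{φ ∈ fs} φ(g)`. [folklore] -/
theorem exists_expr_val_eq_sum (W : ℕ → E → E) (U : σ → ℕ → ℕ → σ) (mulE : E → E → E) (oneE : E)
    (ee : Φ → E) (hD : IsRootedTD nv par bags)
    (hW : ∀ v e st, val (W v e) st = ∑ x ∈ Finset.range d, val e (U st v x))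
    (hmul : ∀ e₁ e₂ st, val (mulE e₁ e₂) st = val e₁ st * val e₂ st) (hone : ∀ st, val oneE st = 1)
    (hee : ∀ φ ∈ fs, ∀ st, val (ee φ) st = fe φ (r st))
    (hloc : ∀ φ ∈ fs, ∀ g g' : ℕ → ℕ, (∀ v ∈ scope φ, g v = g' v) → fe φ g = fe φ g')
    (hU : ∀ t st, ∀ u ∈ bagOf bags t, ∀ v ∈ bagOf bags t, ∀ x, x < d →
      r (U st v x) u = if u = v then x else r st u)
    (hhome : ∀ φ ∈ fs, homeOf bags (scope φ) < bags.length) :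
    ∃ ex : E, ∀ st, val ex st = ∑ g ∈ assignments (Finset.range nv) d, (fs.map fun φ => fe φ g).prod := by
  classical
  -- the descending run: after the bags `≥ t` are processed (JT's invariant, expression messages)
  have key : ∀ j t, t + j = bags.length → ∃ msgs : List (ℕ × E × ((ℕ → ℕ) → R)),
      msgs.map Prod.fst = List.range' t (bags.length - t) ∧
      (∑ g ∈ assignments (Finset.range nv) d, (fs.map fun φ => fe φ g).prod =
        ∑ g ∈ assignments (liveVars nv par bags t) d,
          ((fs.filter fun φ => decide (homeOf bags (scope φ) < t)).map fun φ => fe φ g).prod *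
          ((msgs.filter fun m => decide (m.1 = 0 ∨ parOf par m.1 < t)).map fun m => m.2.2 g).prod) ∧
      ∀ m ∈ msgs, (∀ st, val m.2.1 st = m.2.2 (r st)) ∧
        ∀ g g' : ℕ → ℕ, (∀ v ∈ keptVars par bags m.1, g v = g' v) → m.2.2 g = m.2.2 g' := by
    intro j
    induction j with
    | zero =>
      intro t h
      rw [Nat.add_zero] at h
      subst h
      refine ⟨[], by simp, ?_, fun m hm => absurd hm List.not_mem_nil⟩
      rw [liveVars_length]
      refine Finset.sum_congr rfl fun a _ => ?_
      rw [List.filter_nil, List.map_nil, List.prod_nil, mul_one, List.filter_eq_self.2]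
      intro φ hφ
      simpa using hhome φ hφ
    | succ j ih =>
      intro t h
      have ht : t < bags.length := by omega
      obtain ⟨msgs, hfst, hval, hmsg⟩ := ih (t + 1) (by omega)
      obtain ⟨m, hm⟩ := exprInv_step W U mulE oneE ee hD hW hmul hone hee hloc hU ht hfst hval hmsg
      exact ⟨_, hm⟩
  obtain ⟨msgs, hfst, hval, hmsg⟩ := key bags.length 0 (Nat.zero_add _)
  -- the run records the root's message first
  have hn : bags.length - 0 = (bags.length - 1) + 1 := by have := hD.pos; omega
  rw [hn, List.range'_succ] at hfst
  obtain ⟨m, rest, rfl, hm, hrest⟩ : ∃ m rest, msgs = m :: rest ∧ m.1 = 0 ∧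
      rest.map Prod.fst = List.range' (0 + 1) (bags.length - 1) := by
    cases msgs with
    | nil => simp at hfst
    | cons m rest =>
      rw [List.map_cons, List.cons.injEq] at hfst
      exact ⟨m, rest, rfl, hfst.1, hfst.2⟩
  refine ⟨m.2.1, fun st => ?_⟩
  obtain ⟨hm1, hm2⟩ := hmsg m List.mem_cons_self
  rw [hm1 st, hval, liveVars_zero hD, assignments_empty, Finset.sum_singleton]
  have hfac : (fs.filter fun φ => decide (homeOf bags (scope φ) < 0)) = [] :=
    List.filter_eq_nil_iff.2 fun φ _ => by simp
  have hrest0 : ∀ m' ∈ rest, ¬ (m'.1 = 0 ∨ parOf par m'.1 < 0) := by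
    intro m' hm'
    have : m'.1 ∈ rest.map Prod.fst := List.mem_map_of_mem hm'
    rw [hrest, List.mem_range'] at this
    omega
  rw [hfac, List.map_nil, List.prod_nil, one_mul, List.filter_cons_of_pos (by simp [hm]),
    List.filter_eq_nil_iff.2 fun m' hm' => by simpa using hrest0 m' hm']
  rw [List.map_cons, List.map_nil, List.prod_cons, List.prod_nil, mul_one]
  exact hm2 _ _ fun v hv => by simp [hm, keptVars] at hv

end Run

end Abstract

end Summit.ValiantsHypothesis.ValiantsHypothesis.Theorems.OrbitRestorationQPHomPolyClose
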